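import Summits.CriticalPhenomena.PercolationContinuityZ3.Theorems.Transplant.CayleySkeletonKernel
import HarnessLib

/-!
# `Γ₀ × ℤ` with FACTOR-MIXING generators: one reversible additive height on an arbitrary group `Γ₀` gives `θ(p_c) = 0` on
# `Cay(Γ₀ × ℤ; S)` for EVERY admissible finite `S` — the `ℤ`-factor supplies the axis flip and the central translation

builds on p205010 (kernel theorem, internal audit signed; external expert review pending) — the unconditional theorem runs through the closed D″ node
via `CayleySign.criticalContinuity`, whose proof uses near-one gluing (AdditiveGluing), which builds on p205010.
Lane `prim-bschramm`, seat `prim-bschramm-p4` (gen 9; PART C3, METHOD = abstract closing argument); helper file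
(`--supports stmt-CriticalPhenomena-4575 --as helper`).  Memo `HOME/bschramm/P4-GENERAL.md` §25.5/§25.6.  Sibling of `CayleySkeletonSign/Kernel`.

THE POINT.  The side-on theorem (`CayleySkeletonLine`) reaches `Cay(Γ₀; S₀) □ ℤ` — the generating system of `Γ₀ × ℤ` must SPLIT as
`S₀ × {0} ∪ {1} × {±1}`.  Here the abstract theorem removes the splitting: let `Γ₀` be ANY group with a REVERSIBLE CHARACTER — an additive
`ψ : Γ₀ → ℤ` and a group automorphism `ν₀` with `ψ ∘ ν₀ = −ψ` (`ReversibleChar Γ₀`).  On the Mathlib group `Γ₀ × Multiplicative ℤ` take the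
skeleton `φ = (ψ, t)`, the central inversion `ν = ν₀ × (t ↦ −t)`, the axis flip `κ = id × (t ↦ −t)` and the CENTRAL translating element
`z = (1, t)`.  Then for EVERY finite `S ⊆ Γ₀ × ℤ` with `ν(S) = S = κ(S)`, `|ψ|, |t| ≤ 1` on `S`, unit steps `(ψ, t) = (1, 0)` and `(0, 1)` realised
in `S`, and `⟨S ∩ ker φ⟩ = ker φ`: **`θ_g(p_c) = 0` at every vertex of `Cay(Γ₀ × ℤ; S)`, unconditionally** (`criticalContinuity_prodInt`).  The
generators may mix the factors arbitrarily (`(g₀, t^{±1})` with `ψ(g₀) ∈ {0, ±1}`); `Cay(H₃(ℤ) × ℤ; a,b,c,t,at,at⁻¹)` (`CayleySkeletonCustomers`) is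
the instance `Γ₀ = H₃(ℤ)`, `ψ = x`.
* §1 `ReversibleChar Γ₀`; §2 `φ`, `negProd`, `flipProd`, `zProd` and their identities; §3 **`CayleySign.ofProdInt`**, **`criticalContinuity_prodInt`**.
[cite: BenjaminiSchramm1996, Conj. 4; §2 (Cayley graphs)] [cite: KozmaNitzan2024, §4 p. 16 (Lemma 8: the lattice symmetries)]
[cite: MartineauSevero2019, Cor. 2.2]
-/

noncomputable section

namespace Summit.CriticalPhenomena.PercolationContinuityZ3.Theorems.Transplant

open MeasureTheory Literature.Probability.Percolation Literature.Probability.LatticeModels SimpleGraph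
open scoped Classical

/-! ## §1 Reversible characters -/

/-- **A reversible character** on a group: an additive `ψ : Γ₀ → ℤ` and a group automorphism `ν₀` with `ψ ∘ ν₀ = −ψ`.
[cite: KozmaNitzan2024, §4 p. 16 (Lemma 8)] -/
structure ReversibleChar (Γ₀ : Type) [Group Γ₀] where
  /-- the height -/
  ψ : Γ₀ → ℤ
  /-- additivity -/
  map_mul : ∀ g h : Γ₀, ψ (g * h) = ψ g + ψ h
  /-- the reversing automorphism -/
  ν₀ : Γ₀ ≃* Γ₀
  /-- `ψ ∘ ν₀ = −ψ` -/
  ν₀_ψ : ∀ g, ψ (ν₀ g) = -ψ g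

namespace ReversibleChar

variable {Γ₀ : Type} [Group Γ₀] (R : ReversibleChar Γ₀)

/-- `ψ 1 = 0`. [folklore] -/
theorem ψ_one : R.ψ 1 = 0 := by
  have h := R.map_mul 1 1
  rw [one_mul] at h
  linarith

/-! ## §2 The product group `Γ₀ × ℤ`: skeleton, inversion, flip, central element -/

/-- The skeleton `φ = (ψ, t)` on `Γ₀ × Multiplicative ℤ`. [cite: KozmaNitzan2024, §4 p. 15 (boxes)] -/
def φ (g : Γ₀ × Multiplicative ℤ) : Site 2 := ![R.ψ g.1, Multiplicative.toAdd g.2]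

/-- `φ` at coordinate `0`. [folklore] -/
@[simp] theorem φ_apply_zero (g : Γ₀ × Multiplicative ℤ) : R.φ g 0 = R.ψ g.1 := rfl
/-- `φ` at coordinate `1`. [folklore] -/
@[simp] theorem φ_apply_one (g : Γ₀ × Multiplicative ℤ) : R.φ g 1 = Multiplicative.toAdd g.2 := rfl

/-- `φ` is a homomorphism. [folklore] -/
theorem φ_mul (g h : Γ₀ × Multiplicative ℤ) : R.φ (g * h) = R.φ g + R.φ h := by
  funext j; fin_cases j <;> simp [R.map_mul, toAdd_mul]

/-- The central inversion `ν = ν₀ × (t ↦ −t)`. [cite: KozmaNitzan2024, §4 p. 16 (Lemma 8)] -/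
def negProd : (Γ₀ × Multiplicative ℤ) ≃* (Γ₀ × Multiplicative ℤ) := MulEquiv.prodCongr R.ν₀ (MulEquiv.inv (Multiplicative ℤ))

/-- The axis flip `κ = id × (t ↦ −t)`. [cite: KozmaNitzan2024, §4 p. 16 (Lemma 8)] -/
def flipProd : (Γ₀ × Multiplicative ℤ) ≃* (Γ₀ × Multiplicative ℤ) := MulEquiv.prodCongr (MulEquiv.refl Γ₀) (MulEquiv.inv (Multiplicative ℤ))

/-- `ν` in coordinates. [folklore] -/
@[simp] theorem negProd_apply (g : Γ₀ × Multiplicative ℤ) : R.negProd g = (R.ν₀ g.1, g.2⁻¹) := rfl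

/-- `κ` in coordinates. [folklore] -/
@[simp] theorem flipProd_apply (g : Γ₀ × Multiplicative ℤ) : (flipProd : (Γ₀ × Multiplicative ℤ) ≃* _) g = (g.1, g.2⁻¹) := rfl

/-- `φ ∘ ν = −φ`. [folklore] -/
theorem φ_negProd (g : Γ₀ × Multiplicative ℤ) : R.φ (R.negProd g) = -R.φ g := by
  funext j; fin_cases j <;> simp [R.ν₀_ψ, toAdd_inv]

/-- `φ ∘ κ = flipSnd ∘ φ`. [folklore] -/
theorem φ_flipProd (g : Γ₀ × Multiplicative ℤ) : R.φ ((flipProd : (Γ₀ × Multiplicative ℤ) ≃* _) g) = flipSnd (R.φ g) := by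
  funext j; fin_cases j <;> simp [flipSnd, toAdd_inv]

/-- The translating element `z = (1, t)`. [folklore] -/
def zProd : Γ₀ × Multiplicative ℤ := (1, Multiplicative.ofAdd 1)

/-- `z` is central. [folklore] -/
theorem zProd_central (g : Γ₀ × Multiplicative ℤ) : g * zProd = zProd * g := by
  refine Prod.ext ?_ ?_
  · show g.1 * 1 = 1 * g.1; rw [mul_one, one_mul]
  · show g.2 * Multiplicative.ofAdd 1 = Multiplicative.ofAdd 1 * g.2; exact mul_comm _ _

/-- `φ(z) = e₁ ≠ 0`. [folklore] -/
theorem φ_zProd_ne : R.φ zProd ≠ 0 := fun h => by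
  have h1 := congrFun h 1
  simp [zProd] at h1

/-! ## §3 The structure and the theorem -/

/-- **`CayleySign` on `Γ₀ × ℤ` for EVERY admissible `S`**: `ν(S) = S = κ(S)`, `|ψ|, |t| ≤ 1` on `S`, the two unit steps realised in `S`, and
`⟨S ∩ ker φ⟩ = ker φ`. [cite: KozmaNitzan2024, §4 p. 16 (Lemma 8)] [cite: BenjaminiSchramm1996, §2] -/
def cayleySign (S : Finset (Γ₀ × Multiplicative ℤ)) (hν : ∀ s, R.negProd s ∈ S ↔ s ∈ S)
    (hκ : ∀ s, (flipProd : (Γ₀ × Multiplicative ℤ) ≃* _) s ∈ S ↔ s ∈ S)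
    (lip : ∀ s ∈ S, |R.ψ s.1| ≤ 1 ∧ |Multiplicative.toAdd s.2| ≤ 1)
    (step₀ : ∃ s ∈ S, R.ψ s.1 = 1 ∧ Multiplicative.toAdd s.2 = 0) (step₁ : ∃ s ∈ S, R.ψ s.1 = 0 ∧ Multiplicative.toAdd s.2 = 1)
    (hker : ∀ g : Γ₀ × Multiplicative ℤ, R.φ g = 0 → g ∈ Subgroup.closure (↑(S.filter fun s => R.φ s = 0) : Set (Γ₀ × Multiplicative ℤ))) :
    CayleySign (Γ₀ × Multiplicative ℤ) S where
  toCayleyNeg := CayleyNeg.ofCentral R.φ R.φ_mul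
    (fun s hs i => by
      fin_cases i
      · exact (lip s hs).1
      · exact (lip s hs).2)
    (fun i => by
      fin_cases i
      · obtain ⟨s, hs, h1, h2⟩ := step₀
        exact ⟨s, hs, by funext j; fin_cases j <;> simp [h1, h2]⟩
      · obtain ⟨s, hs, h1, h2⟩ := step₁
        exact ⟨s, hs, by funext j; fin_cases j <;> simp [h1, h2]⟩)
    R.negProd hν R.φ_negProd
    (fun ℓ _ => CayleyKernel.cyl_connected_of_ker_generated R.φ R.φ_mul
      (fun i => by
        fin_cases i
        · obtain ⟨s, hs, h1, h2⟩ := step₀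
          exact ⟨s, hs, by funext j; fin_cases j <;> simp [h1, h2]⟩
        · obtain ⟨s, hs, h1, h2⟩ := step₁
          exact ⟨s, hs, by funext j; fin_cases j <;> simp [h1, h2]⟩) hker ℓ)
    zProd zProd_central R.φ_zProd_ne
  κ := flipProd
  κ_mem := hκ
  κ_φ := R.φ_flipProd

/-- **THEOREM: `θ_g(p_c) = 0` at every vertex of `Cay(Γ₀ × ℤ; S)`** for every group `Γ₀` with a reversible character and EVERY finite `S` as in
`cayleySign` — factor-mixing generators allowed; unconditional (closed D″ node; Φ2 by the central translation `(1, t)`).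
builds on p205010 (kernel theorem, internal audit signed; external expert review pending). [cite: BenjaminiSchramm1996, Conj. 4; §2] -/
theorem criticalContinuity_prodInt (S : Finset (Γ₀ × Multiplicative ℤ)) (hν : ∀ s, R.negProd s ∈ S ↔ s ∈ S)
    (hκ : ∀ s, (flipProd : (Γ₀ × Multiplicative ℤ) ≃* _) s ∈ S ↔ s ∈ S)
    (lip : ∀ s ∈ S, |R.ψ s.1| ≤ 1 ∧ |Multiplicative.toAdd s.2| ≤ 1)
    (step₀ : ∃ s ∈ S, R.ψ s.1 = 1 ∧ Multiplicative.toAdd s.2 = 0) (step₁ : ∃ s ∈ S, R.ψ s.1 = 0 ∧ Multiplicative.toAdd s.2 = 1)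
    (hker : ∀ g : Γ₀ × Multiplicative ℤ, R.φ g = 0 → g ∈ Subgroup.closure (↑(S.filter fun s => R.φ s = 0) : Set (Γ₀ × Multiplicative ℤ)))
    (g : Γ₀ × Multiplicative ℤ) :
    theta (mulCayley (S : Set (Γ₀ × Multiplicative ℤ))) g (criticalProbIOf (mulCayley (S : Set (Γ₀ × Multiplicative ℤ))) g) = 0 :=
  (R.cayleySign S hν hκ lip step₀ step₁ hker).criticalContinuity g

end ReversibleChar

end Summit.CriticalPhenomena.PercolationContinuityZ3.Theorems.Transplant

end
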